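import Literature.NumberTheory.Transcendental.OddZetaSeries
import HarnessLib

/-!
# Odd zeta values III: elementary asymptotics of the twisted Ball–Rivoal sums

For the rational function `R_n = Rfun r D s n` of `OddZetaSeries.lean` we study the samples

`u_q = R_n(rn + q/D)`, `q = 0, 1, 2, …`

(so that the twisted sums of Sprang / Fischler–Sprang–Zudilin are the residue-class sums
`r_{n,j} = ∑_k u_{kD+j}`, `1 ≤ j ≤ D`) and the ratios `ρ_q = u_{q+1}/u_q`,

`ρ_q = (1 + (L+1)/q) · P_q`, `P_q = ∏_{k=0}^{n} (Y_{q,k}/(Y_{q,k}+1))^{s+1}`,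
`Y_{q,k} = Drn + q + Dk`.

This file replaces the Stirling/saddle-point analysis of FSZ 2019, Lemma 3 (`r_{n,j'}/r_{n,j} → 1`)
by crude, explicit inequalities which suffice for *non-vanishing* of the eliminating
combination (all we need for irrationality, as opposed to the dimension bound):

* closed form, positivity and the ratio recursion (`useq_eq`, `useq_pos`, `useq_succ`);
* bounds for `P_q` by Bernoulli's inequality and telescoping (`Pq_le`, `Pq_ge`, `Pq_succ_le`);
* (F1) the drift bound `q ρ_q ≤ (q+1) ρ_{q+1}`; (F3) log-concavity `ρ_{q+1} ≤ ρ_q` for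
  `q ≤ D(rn-1)/(4σ)`; (F2) `ρ_q ≤ 1` beyond `Q₂`; (F4) `ρ_q ≥ 2` for bounded `q` and large `n`;
* (F5) the upper bound `∑_q u_q ≤ 3Dr · γ^n`, `γ = (3Dr)^{(2r+1)D} / r^{s+1}`.

The combinatorial consequences (unimodality, comparison of the residue-class sums) are drawn
in `OddZetaElimination.lean`.

## References
* [FischlerSprangZudilin2019] S. Fischler, J. Sprang, W. Zudilin, Compositio Math. 155 (2019),
  §4 Lemma 3 (the statement replaced here by elementary bounds) (arXiv:1803.08905).
* [Zudilin2018OddZeta] W. Zudilin, SIGMA 14 (2018) 028, §3.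
-/

noncomputable section

open Finset Filter Topology

open scoped Nat

namespace Literature.NumberTheory.Transcendental.OddZeta

/-! ### Samples, closed form, ratio -/

/-- `Y_{q,k} = Drn + q + Dk` (a natural number). [folklore] -/
def Ynat (r D n q k : ℕ) : ℕ := D * r * n + q + D * k

/-- The samples `u_q = R_n(rn + q/D)`. [cite: FischlerSprangZudilin2019, §4 (c_{k,j} = R_n(n+k+j/D))] -/
def useq (r D s n q : ℕ) : ℝ := Rfun r D s n (r * n + (q : ℝ) / D)

/-- The normalising constant `C_n = n!^{s+1-(2r+1)D} D^{(n+1)(s+1)} / D`. [folklore] -/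
def Cn (r D s n : ℕ) : ℝ :=
  (n ! : ℝ) ^ (s + 1 - (2 * r + 1) * D) * (D : ℝ) ^ ((n + 1) * (s + 1)) / D

/-- `P_q = ∏_{k ≤ n} (Y_{q,k}/(Y_{q,k}+1))^{s+1}`. [cite: FischlerSprangZudilin2019, §4 eq. (4.3)] -/
def Pq (r D s n q : ℕ) : ℝ :=
  ∏ k ∈ range (n + 1), ((Ynat r D n q k : ℝ) / ((Ynat r D n q k : ℝ) + 1)) ^ (s + 1)

/-- The ratio `ρ_q = (1 + (L+1)/q) P_q` (`= u_{q+1}/u_q` for `q ≥ 1`).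
[cite: FischlerSprangZudilin2019, §4 eq. (4.3)] -/
def rho (r D s n q : ℕ) : ℝ := (((q : ℝ) + (Lnum r D n + 1)) / q) * Pq r D s n q

/-- **Closed form**: `u_q = C_n ∏_{l ≤ L}(q+l) / ∏_{k ≤ n} Y_{q,k}^{s+1}`. [folklore] -/
theorem useq_eq {r D s n : ℕ} (hD : 0 < D) (q : ℕ) :
    useq r D s n q = Cn r D s n * (∏ l ∈ range (Lnum r D n + 1), ((q : ℝ) + l)) /
      ∏ k ∈ range (n + 1), (Ynat r D n q k : ℝ) ^ (s + 1) := by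
  have hD' : (D : ℝ) ≠ 0 := by exact_mod_cast hD.ne'
  unfold useq Rfun Cn
  have hnum : ∏ l ∈ range (Lnum r D n + 1), ((r : ℝ) * n + (q : ℝ) / D - r * n + (l : ℝ) / D) =
      (∏ l ∈ range (Lnum r D n + 1), ((q : ℝ) + l)) / (D : ℝ) ^ (Lnum r D n + 1) := by
    rw [eq_div_iff (by positivity), ← card_range (Lnum r D n + 1), ← prod_const, card_range,
      ← prod_mul_distrib]
    refine prod_congr rfl fun l _ => ?_
    field_simp
    ring
  have hden : ∏ k ∈ range (n + 1), ((r : ℝ) * n + (q : ℝ) / D + k) ^ (s + 1) =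
      (∏ k ∈ range (n + 1), (Ynat r D n q k : ℝ) ^ (s + 1)) / (D : ℝ) ^ ((n + 1) * (s + 1)) := by
    rw [eq_div_iff (by positivity), pow_mul, ← card_range (n + 1), ← prod_const, card_range,
      ← prod_pow, ← prod_mul_distrib]
    refine prod_congr rfl fun k _ => ?_
    rw [← mul_pow]
    congr 1
    unfold Ynat
    push_cast
    field_simp
  rw [hnum, hden, pow_succ]
  field_simp

/-- `u_q > 0` for `q ≥ 1`. [folklore] -/
theorem useq_pos {r D s n : ℕ} (hD : 0 < D) {q : ℕ} (hq : 1 ≤ q) : 0 < useq r D s n q := by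
  rw [useq_eq hD]
  have hq' : (0 : ℝ) < q := by exact_mod_cast hq
  have hY : ∀ k, (0 : ℝ) < (Ynat r D n q k : ℝ) := fun k => by
    unfold Ynat; exact_mod_cast (show 0 < D * r * n + q + D * k by omega)
  unfold Cn
  have : (0 : ℝ) < D := by exact_mod_cast hD
  have h1 : 0 < ∏ l ∈ range (Lnum r D n + 1), ((q : ℝ) + l) := prod_pos fun l _ => by positivity
  have h2 : 0 < ∏ k ∈ range (n + 1), (Ynat r D n q k : ℝ) ^ (s + 1) :=
    prod_pos fun k _ => pow_pos (hY k) _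
  positivity

/-- `u_0 = 0` (`t = rn` is a zero of `R_n`). [folklore] -/
theorem useq_zero (r D s n : ℕ) : useq r D s n 0 = 0 := by
  unfold useq Rfun
  rw [prod_eq_zero (i := 0) (mem_range.2 (Nat.succ_pos _))]
  · simp
  · simp

/-- `P_q > 0`. [folklore] -/
theorem Pq_pos (r D s n q : ℕ) (hq : 1 ≤ q) : 0 < Pq r D s n q := by
  unfold Pq
  refine prod_pos fun k _ => pow_pos (div_pos ?_ ?_) _
  · unfold Ynat; exact_mod_cast (show 0 < D * r * n + q + D * k by omega)
  · positivity

/-- **Ratio recursion**: `u_{q+1} = ρ_q u_q` for `q ≥ 1`. [cite: FischlerSprangZudilin2019, §4 eq. (4.3)] -/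
theorem useq_succ {r D s n : ℕ} (hD : 0 < D) {q : ℕ} (hq : 1 ≤ q) :
    useq r D s n (q + 1) = rho r D s n q * useq r D s n q := by
  have hq' : (0 : ℝ) < q := by exact_mod_cast hq
  have hY : ∀ k, (0 : ℝ) < (Ynat r D n q k : ℝ) := fun k => by
    unfold Ynat; exact_mod_cast (show 0 < D * r * n + q + D * k by omega)
  have hYs : ∀ k, (Ynat r D n (q + 1) k : ℝ) = (Ynat r D n q k : ℝ) + 1 := fun k => by
    unfold Ynat; push_cast; ring
  rw [useq_eq hD, useq_eq hD, rho, Pq]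
  -- the numerator products
  have hnum : (∏ l ∈ range (Lnum r D n + 1), (((q + 1 : ℕ) : ℝ) + l)) * q =
      (∏ l ∈ range (Lnum r D n + 1), ((q : ℝ) + l)) * ((q : ℝ) + (Lnum r D n + 1)) := by
    have e1 : ∏ l ∈ range (Lnum r D n + 1 + 1), ((q : ℝ) + l) =
        (∏ l ∈ range (Lnum r D n + 1), (((q + 1 : ℕ) : ℝ) + l)) * q := by
      rw [prod_range_succ']
      push_cast
      simp only [add_zero]
      congr 1
      exact prod_congr rfl fun l _ => by ring
    rw [← e1, prod_range_succ]
    push_cast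
    ring
  -- the denominator products
  have hden : ∏ k ∈ range (n + 1), (Ynat r D n (q + 1) k : ℝ) ^ (s + 1) =
      ∏ k ∈ range (n + 1), ((Ynat r D n q k : ℝ) + 1) ^ (s + 1) :=
    prod_congr rfl fun k _ => by rw [hYs k]
  rw [hden]
  have hP1 : ∏ k ∈ range (n + 1), ((Ynat r D n q k : ℝ) / ((Ynat r D n q k : ℝ) + 1)) ^ (s + 1) =
      (∏ k ∈ range (n + 1), (Ynat r D n q k : ℝ) ^ (s + 1)) /
        ∏ k ∈ range (n + 1), ((Ynat r D n q k : ℝ) + 1) ^ (s + 1) := by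
    rw [← prod_div_distrib]
    exact prod_congr rfl fun k _ => by rw [div_pow]
  rw [hP1]
  have hA : 0 < ∏ k ∈ range (n + 1), (Ynat r D n q k : ℝ) ^ (s + 1) :=
    prod_pos fun k _ => pow_pos (hY k) _
  have hB : 0 < ∏ k ∈ range (n + 1), ((Ynat r D n q k : ℝ) + 1) ^ (s + 1) :=
    prod_pos fun k _ => by positivity
  set X := ∏ l ∈ range (Lnum r D n + 1), (((q + 1 : ℕ) : ℝ) + l) with hX
  set X0 := ∏ l ∈ range (Lnum r D n + 1), ((q : ℝ) + l) with hX0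
  set A := ∏ k ∈ range (n + 1), (Ynat r D n q k : ℝ) ^ (s + 1) with hAdef
  set B := ∏ k ∈ range (n + 1), ((Ynat r D n q k : ℝ) + 1) ^ (s + 1) with hBdef
  have hA' := hA.ne'
  have hB' := hB.ne'
  field_simp
  linear_combination (Cn r D s n) * hnum

/-! ### Bernoulli–telescoping bounds for `P_q` -/

/-- Telescoping product `∏_{k<m} g(k)/g(k+1) = g(0)/g(m)` for non-vanishing `g`. [folklore] -/
theorem prod_range_div_telescope (g : ℕ → ℝ) (hg : ∀ k, g k ≠ 0) (m : ℕ) :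
    ∏ k ∈ range m, (g k / g (k + 1)) = g 0 / g m := by
  induction m with
  | zero => simp [hg 0]
  | succ m ih =>
    rw [prod_range_succ, ih]
    have h1 := hg m; have h2 := hg (m + 1); have h0 := hg 0
    field_simp

/-- `(Y/(Y+1))^D ≤ (Y+1)/(Y+1+D)` for `Y ≥ 0` (Bernoulli). [folklore] -/
theorem div_pow_le (Y : ℝ) (hY : 0 ≤ Y) (D : ℕ) :
    (Y / (Y + 1)) ^ D ≤ (Y + 1) / (Y + 1 + D) := by
  have h1 : 0 < Y + 1 := by linarith
  -- `(1 + 1/(Y+1))^D ≥ 1 + D/(Y+1)` and `(Y/(Y+1)) (1 + 1/(Y+1)) ≤ 1`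
  have hpos : (0 : ℝ) ≤ 1 / (Y + 1) := by positivity
  have hb : 1 + (D : ℝ) * (1 / (Y + 1)) ≤ (1 + 1 / (Y + 1)) ^ D :=
    one_add_mul_le_pow (by linarith) D
  have hprod : (Y / (Y + 1)) * (1 + 1 / (Y + 1)) ≤ 1 := by
    rw [show (Y / (Y + 1)) * (1 + 1 / (Y + 1)) = 1 - 1 / (Y + 1) ^ 2 by field_simp; ring]
    have : 0 ≤ 1 / (Y + 1) ^ 2 := by positivity
    linarith
  have h0 : 0 ≤ Y / (Y + 1) := by positivity
  have h2 : (Y / (Y + 1)) ^ D * (1 + 1 / (Y + 1)) ^ D ≤ 1 := by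
    rw [← mul_pow]; exact pow_le_one₀ (by positivity) hprod
  have h3 : 0 < (1 + 1 / (Y + 1)) ^ D := by positivity
  have h4 : (Y / (Y + 1)) ^ D ≤ 1 / (1 + 1 / (Y + 1)) ^ D := by
    rw [le_div_iff₀ h3]; exact h2
  refine h4.trans ?_
  have h5 : 0 < 1 + (D : ℝ) * (1 / (Y + 1)) := by positivity
  calc 1 / (1 + 1 / (Y + 1)) ^ D ≤ 1 / (1 + (D : ℝ) * (1 / (Y + 1))) :=
        one_div_le_one_div_of_le h5 hb
    _ = (Y + 1) / (Y + 1 + D) := by field_simp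

/-- `(Y/(Y+1))^D ≥ (Y+1-D)/(Y+1)` for `Y ≥ 0` (Bernoulli). [folklore] -/
theorem div_pow_ge (Y : ℝ) (hY : 0 ≤ Y) (D : ℕ) :
    (Y + 1 - D) / (Y + 1) ≤ (Y / (Y + 1)) ^ D := by
  have h1 : 0 < Y + 1 := by linarith
  have e : Y / (Y + 1) = 1 + (-(1 / (Y + 1))) := by field_simp; ring
  have hb : 1 + (D : ℝ) * (-(1 / (Y + 1))) ≤ (1 + (-(1 / (Y + 1)))) ^ D := by
    refine one_add_mul_le_pow ?_ D
    have : 1 / (Y + 1) ≤ 1 := by rw [div_le_one h1]; linarith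
    linarith
  rw [e]
  refine le_trans (le_of_eq ?_) hb
  field_simp
  ring

/-- **Upper bound for `P_q`**: `P_q ≤ ((Y₀+1)/(Y₀+1+D(n+1)))^σ` when `s+1 = Dσ`, by Bernoulli
and telescoping (`Y_{q,k} + D = Y_{q,k+1}`). [folklore] -/
theorem Pq_le {r D s n σ q : ℕ} (hS : s + 1 = D * σ) :
    Pq r D s n q ≤ ((((Ynat r D n q 0 : ℝ) + 1)) / ((Ynat r D n q 0 : ℝ) + 1 + D * (n + 1))) ^ σ := by
  unfold Pq
  rw [hS]
  simp_rw [pow_mul]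
  rw [prod_pow]
  have hYnn : ∀ k, (0 : ℝ) ≤ (Ynat r D n q k : ℝ) := fun k => Nat.cast_nonneg _
  refine pow_le_pow_left₀ (prod_nonneg fun k _ => pow_nonneg (by
    have := hYnn k; positivity) _) ?_ σ
  -- termwise Bernoulli, then telescope
  have hstep : ∀ k, ((Ynat r D n q k : ℝ) / ((Ynat r D n q k : ℝ) + 1)) ^ D ≤
      ((Ynat r D n q k : ℝ) + 1) / ((Ynat r D n q (k + 1) : ℝ) + 1) := by
    intro k
    have h := div_pow_le _ (hYnn k) D
    have e : (Ynat r D n q (k + 1) : ℝ) + 1 = (Ynat r D n q k : ℝ) + 1 + D := by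
      unfold Ynat; push_cast; ring
    rwa [e]
  calc ∏ k ∈ range (n + 1), ((Ynat r D n q k : ℝ) / ((Ynat r D n q k : ℝ) + 1)) ^ D
      ≤ ∏ k ∈ range (n + 1), (((Ynat r D n q k : ℝ) + 1) / ((Ynat r D n q (k + 1) : ℝ) + 1)) :=
        prod_le_prod (fun k _ => by have := hYnn k; positivity) fun k _ => hstep k
    _ = ((Ynat r D n q 0 : ℝ) + 1) / ((Ynat r D n q (n + 1) : ℝ) + 1) :=
        prod_range_div_telescope (fun k => (Ynat r D n q k : ℝ) + 1)
          (fun k => by have := hYnn k; positivity) (n + 1)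
    _ = _ := by
        congr 1
        unfold Ynat; push_cast; ring

/-- **Lower bound for `P_q`**: `((Y₀+1-D)/(Y₀+1+Dn))^σ ≤ P_q` when `s+1 = Dσ` and
`D ≤ Y₀ + 1`. [folklore] -/
theorem Pq_ge {r D s n σ q : ℕ} (hS : s + 1 = D * σ) (hq : D ≤ Ynat r D n q 0) :
    (((Ynat r D n q 0 : ℝ) + 1 - D) / ((Ynat r D n q 0 : ℝ) + 1 + D * n)) ^ σ ≤ Pq r D s n q := by
  unfold Pq
  rw [hS]
  simp_rw [pow_mul]
  rw [prod_pow]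
  have hYnn : ∀ k, (0 : ℝ) ≤ (Ynat r D n q k : ℝ) := fun k => Nat.cast_nonneg _
  have hY0 : (D : ℝ) ≤ (Ynat r D n q 0 : ℝ) := by exact_mod_cast hq
  have hYk : ∀ k, (Ynat r D n q 0 : ℝ) ≤ (Ynat r D n q k : ℝ) := fun k => by
    unfold Ynat; push_cast; nlinarith [(Nat.cast_nonneg (α := ℝ) D), (Nat.cast_nonneg (α := ℝ) k)]
  have hnn0 : 0 ≤ ((Ynat r D n q 0 : ℝ) + 1 - D) / ((Ynat r D n q 0 : ℝ) + 1 + D * n) := by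
    apply div_nonneg <;> nlinarith [(Nat.cast_nonneg (α := ℝ) D), (Nat.cast_nonneg (α := ℝ) n)]
  refine pow_le_pow_left₀ hnn0 ?_ σ
  have hstep : ∀ k, ((Ynat r D n q k : ℝ) + 1 - D) / ((Ynat r D n q k : ℝ) + 1) ≤
      ((Ynat r D n q k : ℝ) / ((Ynat r D n q k : ℝ) + 1)) ^ D := fun k => div_pow_ge _ (hYnn k) D
  have e : ∀ k, (Ynat r D n q (k + 1) : ℝ) + 1 - D = (Ynat r D n q k : ℝ) + 1 := by
    intro k; unfold Ynat; push_cast; ring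
  calc ((Ynat r D n q 0 : ℝ) + 1 - D) / ((Ynat r D n q 0 : ℝ) + 1 + D * n)
      = ((Ynat r D n q 0 : ℝ) + 1 - D) / ((Ynat r D n q n : ℝ) + 1) := by
        congr 1; unfold Ynat; push_cast; ring
    _ = ∏ k ∈ range (n + 1), (((Ynat r D n q k : ℝ) + 1 - D) / ((Ynat r D n q k : ℝ) + 1)) := by
        -- telescoping: numerator at `k+1` equals denominator at `k`
        have ht : ∏ k ∈ range (n + 1), (((Ynat r D n q k : ℝ) + 1 - D) /
            ((Ynat r D n q (k + 1) : ℝ) + 1 - D)) =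
            ((Ynat r D n q 0 : ℝ) + 1 - D) / ((Ynat r D n q (n + 1) : ℝ) + 1 - D) :=
          prod_range_div_telescope (fun k => (Ynat r D n q k : ℝ) + 1 - D)
            (fun k => by have := hYk k; linarith) (n + 1)
        rw [show ((Ynat r D n q (n + 1) : ℝ) + 1 - D) = (Ynat r D n q n : ℝ) + 1 from e n] at ht
        rw [← ht]
        exact prod_congr rfl fun k _ => by rw [e k]
    _ ≤ ∏ k ∈ range (n + 1), ((Ynat r D n q k : ℝ) / ((Ynat r D n q k : ℝ) + 1)) ^ D := by
        refine prod_le_prod (fun k _ => div_nonneg ?_ ?_) fun k _ => hstep k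
        · linarith [hYk k]
        · have := hYnn k; positivity

/-! ### (F1) The drift bound -/

/-- `P_q ≤ P_{q+1}` (each factor `Y/(Y+1)` increases with `Y`). [folklore] -/
theorem Pq_mono {r D s n q : ℕ} : Pq r D s n q ≤ Pq r D s n (q + 1) := by
  unfold Pq
  have hYnn : ∀ k, (0 : ℝ) ≤ (Ynat r D n q k : ℝ) := fun k => Nat.cast_nonneg _
  have hYs : ∀ k, (Ynat r D n (q + 1) k : ℝ) = (Ynat r D n q k : ℝ) + 1 := fun k => by
    unfold Ynat; push_cast; ring
  refine prod_le_prod (fun k _ => by have := hYnn k; positivity) fun k _ => ?_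
  rw [hYs k]
  refine pow_le_pow_left₀ (by have := hYnn k; positivity) ?_ _
  have := hYnn k
  rw [div_le_div_iff₀ (by positivity) (by positivity)]
  nlinarith

/-- **(F1) Drift bound**: `q ρ_q ≤ (q+1) ρ_{q+1}` for `q ≥ 1`. [folklore] -/
theorem rho_drift {r D s n q : ℕ} (hq : 1 ≤ q) :
    (q : ℝ) * rho r D s n q ≤ ((q : ℝ) + 1) * rho r D s n (q + 1) := by
  have hq' : (0 : ℝ) < q := by exact_mod_cast hq
  have hP := Pq_mono (r := r) (D := D) (s := s) (n := n) (q := q)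
  have hP0 : 0 ≤ Pq r D s n q := (Pq_pos r D s n q hq).le
  unfold rho
  push_cast
  rw [show (q : ℝ) * (((q : ℝ) + (Lnum r D n + 1)) / q * Pq r D s n q) =
      ((q : ℝ) + (Lnum r D n + 1)) * Pq r D s n q by field_simp]
  rw [show ((q : ℝ) + 1) * (((q : ℝ) + 1 + (Lnum r D n + 1)) / ((q : ℝ) + 1) * Pq r D s n (q + 1)) =
      ((q : ℝ) + 1 + (Lnum r D n + 1)) * Pq r D s n (q + 1) by field_simp]
  have hA : (0 : ℝ) ≤ (q : ℝ) + (Lnum r D n + 1) := by positivity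
  nlinarith [mul_le_mul_of_nonneg_left hP hA]

/-! ### (F3) Log-concavity near the origin -/

/-- Weierstrass' product inequality `1 - ∑ ε_k ≤ ∏ (1 - ε_k)` for `ε_k ∈ [0,1]`. [folklore] -/
theorem one_sub_sum_le_prod {ι : Type*} (t : Finset ι) {ε : ι → ℝ} (h0 : ∀ k ∈ t, 0 ≤ ε k)
    (h1 : ∀ k ∈ t, ε k ≤ 1) : 1 - ∑ k ∈ t, ε k ≤ ∏ k ∈ t, (1 - ε k) := by
  classical
  induction t using Finset.induction_on with
  | empty => simp
  | insert a t ha ih =>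
    rw [sum_insert ha, prod_insert ha]
    have ih' := ih (fun k hk => h0 k (mem_insert_of_mem hk)) fun k hk => h1 k (mem_insert_of_mem hk)
    have ha0 := h0 a (mem_insert_self a t)
    have ha1 := h1 a (mem_insert_self a t)
    have hp : ∏ k ∈ t, (1 - ε k) ≤ 1 := prod_le_one (fun k hk => by
      linarith [h1 k (mem_insert_of_mem hk)]) fun k hk => by linarith [h0 k (mem_insert_of_mem hk)]
    nlinarith

/-- `(∏(1+ε_k))^S ≤ 1/(1 - S ∑ ε_k)` for `ε_k ≥ 0`, `S ≥ 1`, `S ∑ ε_k < 1`. [folklore] -/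
theorem prod_one_add_pow_le {ι : Type*} (t : Finset ι) {ε : ι → ℝ} (h0 : ∀ k ∈ t, 0 ≤ ε k)
    (S : ℕ) (hS1 : 1 ≤ S) (hS : (S : ℝ) * ∑ k ∈ t, ε k < 1) :
    (∏ k ∈ t, (1 + ε k)) ^ S ≤ 1 / (1 - S * ∑ k ∈ t, ε k) := by
  set E := ∑ k ∈ t, ε k with hE
  have hE0 : 0 ≤ E := sum_nonneg h0
  have hS1' : (1 : ℝ) ≤ S := by exact_mod_cast hS1
  have hE1 : E < 1 := by nlinarith
  have hεlt : ∀ k ∈ t, ε k < 1 := fun k hk =>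
    lt_of_le_of_lt (single_le_sum h0 hk) hE1
  have hW : 1 - E ≤ ∏ k ∈ t, (1 - ε k) := one_sub_sum_le_prod t h0 fun k hk => (hεlt k hk).le
  have h1 : (∏ k ∈ t, (1 + ε k)) * ∏ k ∈ t, (1 - ε k) ≤ 1 := by
    rw [← prod_mul_distrib]
    refine prod_le_one (fun k hk => ?_) fun k hk => ?_
    · have := h0 k hk; have := hεlt k hk
      exact mul_nonneg (by linarith) (by linarith)
    · have := h0 k hk; nlinarith
  have hP0 : 0 ≤ ∏ k ∈ t, (1 + ε k) := prod_nonneg fun k hk => by linarith [h0 k hk]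
  have h2 : ∏ k ∈ t, (1 + ε k) ≤ 1 / (1 - E) := by
    rw [le_div_iff₀ (by linarith)]
    calc (∏ k ∈ t, (1 + ε k)) * (1 - E) ≤ (∏ k ∈ t, (1 + ε k)) * ∏ k ∈ t, (1 - ε k) :=
          mul_le_mul_of_nonneg_left hW hP0
      _ ≤ 1 := h1
  have h3 : (∏ k ∈ t, (1 + ε k)) ^ S ≤ (1 / (1 - E)) ^ S := pow_le_pow_left₀ hP0 h2 S
  have hB : 1 - S * E ≤ (1 - E) ^ S := by
    have := one_add_mul_le_pow (a := -E) (by linarith) S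
    calc 1 - S * E = 1 + S * (-E) := by ring
      _ ≤ (1 + -E) ^ S := this
      _ = (1 - E) ^ S := by ring
  have h4 : (1 / (1 - E)) ^ S ≤ 1 / (1 - S * E) := by
    rw [div_pow, one_pow]
    exact one_div_le_one_div_of_le (by linarith) hB
  exact h3.trans h4

/-- **Ratio of consecutive `P`'s**: `P_{q+1} ≤ P_q / (1 - S/(D(Y₀ - D)))` (`S = s+1`,
`Y₀ = Drn + q`), valid when `D < Y₀` and `S/(D(Y₀-D)) < 1`. [folklore] -/
theorem Pq_succ_le {r D s n q : ℕ} (hD : 0 < D) (hY : D < Ynat r D n q 0)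
    (hτ : ((s + 1 : ℕ) : ℝ) / (D * ((Ynat r D n q 0 : ℝ) - D)) < 1) :
    Pq r D s n (q + 1) ≤ Pq r D s n q / (1 - ((s + 1 : ℕ) : ℝ) / (D * ((Ynat r D n q 0 : ℝ) - D))) := by
  have hD' : (0 : ℝ) < D := by exact_mod_cast hD
  have hY0 : (D : ℝ) < (Ynat r D n q 0 : ℝ) := by exact_mod_cast hY
  have hYk : ∀ k, (Ynat r D n q k : ℝ) = (Ynat r D n q 0 : ℝ) + D * k := fun k => by
    unfold Ynat; push_cast; ring
  have hYpos : ∀ k, (D : ℝ) < (Ynat r D n q k : ℝ) := fun k => by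
    rw [hYk k]; nlinarith [(Nat.cast_nonneg (α := ℝ) k)]
  set ε : ℕ → ℝ := fun k => 1 / ((Ynat r D n q k : ℝ) * ((Ynat r D n q k : ℝ) + 2)) with hε
  have hε0 : ∀ k, 0 ≤ ε k := fun k => by
    have := hYpos k; rw [hε]; positivity
  -- `P_{q+1} = P_q · (∏ (1+ε_k))^S`
  have hYs : ∀ k, (Ynat r D n (q + 1) k : ℝ) = (Ynat r D n q k : ℝ) + 1 := fun k => by
    unfold Ynat; push_cast; ring
  have hrel : Pq r D s n (q + 1) = Pq r D s n q * (∏ k ∈ range (n + 1), (1 + ε k)) ^ (s + 1) := by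
    unfold Pq
    rw [← prod_pow, ← prod_mul_distrib]
    refine prod_congr rfl fun k _ => ?_
    rw [hYs k, ← mul_pow]
    congr 1
    have h1 : (0 : ℝ) < (Ynat r D n q k : ℝ) := by linarith [hYpos k, hD']
    rw [hε]
    field_simp
    ring
  -- `∑ ε_k ≤ 1/(D (Y₀ - D))`
  have hYsucc : ∀ k, (Ynat r D n q (k + 1) : ℝ) = (Ynat r D n q k : ℝ) + D := fun k => by
    unfold Ynat; push_cast; ring
  have hsumε : ∑ k ∈ range (n + 1), ε k ≤ 1 / (D * ((Ynat r D n q 0 : ℝ) - D)) := by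
    set g : ℕ → ℝ := fun k => 1 / ((Ynat r D n q k : ℝ) - D) with hg
    have hgk : ∀ k, ε k ≤ (1 / D) * (g k - g (k + 1)) := by
      intro k
      have h1 : (0 : ℝ) < (Ynat r D n q k : ℝ) - D := by linarith [hYpos k]
      have h2 : (0 : ℝ) < (Ynat r D n q k : ℝ) := by linarith [hYpos k, hD']
      have e : (1 / D) * (g k - g (k + 1)) = 1 / (((Ynat r D n q k : ℝ) - D) * (Ynat r D n q k : ℝ)) := by
        rw [hg]
        simp only
        rw [hYsucc k, add_sub_cancel_right]
        field_simp
        ring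
      rw [e, hε]
      simp only
      refine one_div_le_one_div_of_le (by positivity) ?_
      nlinarith
    calc ∑ k ∈ range (n + 1), ε k ≤ ∑ k ∈ range (n + 1), (1 / D) * (g k - g (k + 1)) :=
          sum_le_sum fun k _ => hgk k
      _ = (1 / D) * (g 0 - g (n + 1)) := by rw [← mul_sum, sum_range_sub']
      _ ≤ (1 / D) * g 0 := by
          have : 0 ≤ g (n + 1) := by
            rw [hg]; have := hYpos (n + 1); simp only; exact le_of_lt (by
              apply div_pos one_pos; linarith)
          have hD1 : (0 : ℝ) ≤ 1 / D := by positivity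
          nlinarith
      _ = 1 / (D * ((Ynat r D n q 0 : ℝ) - D)) := by rw [hg]; simp only; field_simp
  -- conclude
  have hS1 : 1 ≤ s + 1 := by omega
  have hSε : ((s + 1 : ℕ) : ℝ) * ∑ k ∈ range (n + 1), ε k ≤
      ((s + 1 : ℕ) : ℝ) / (D * ((Ynat r D n q 0 : ℝ) - D)) := by
    rw [div_eq_mul_one_div]
    exact mul_le_mul_of_nonneg_left hsumε (by positivity)
  have hlt : ((s + 1 : ℕ) : ℝ) * ∑ k ∈ range (n + 1), ε k < 1 := lt_of_le_of_lt hSε hτ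
  have hmain := prod_one_add_pow_le (range (n + 1)) (fun k _ => hε0 k) (s + 1) hS1 hlt
  have hP0 : 0 ≤ Pq r D s n q := by
    unfold Pq
    exact prod_nonneg fun k _ => pow_nonneg (by
      have := hYpos k; have : (0:ℝ) ≤ (Ynat r D n q k : ℝ) := Nat.cast_nonneg _; positivity) _
  rw [hrel, div_eq_mul_one_div]
  refine mul_le_mul_of_nonneg_left (hmain.trans ?_) hP0
  exact one_div_le_one_div_of_le (by linarith) (by linarith)

/-- **(F3) Log-concavity step**: `ρ_{q+1} ≤ ρ_q` provided `q ≥ 1`, `D < Y₀`,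
`τ = (s+1)/(D(Y₀-D)) < 1` and `τ (q + L + 1)(q+1) ≤ L + 1`. [folklore] -/
theorem rho_succ_le {r D s n q : ℕ} (hD : 0 < D) (hq : 1 ≤ q) (hY : D < Ynat r D n q 0)
    (hτ : ((s + 1 : ℕ) : ℝ) / (D * ((Ynat r D n q 0 : ℝ) - D)) < 1)
    (hτA : ((s + 1 : ℕ) : ℝ) / (D * ((Ynat r D n q 0 : ℝ) - D)) * ((q : ℝ) + (Lnum r D n + 1)) * (q + 1)
      ≤ (Lnum r D n + 1 : ℕ)) :
    rho r D s n (q + 1) ≤ rho r D s n q := by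
  set τ := ((s + 1 : ℕ) : ℝ) / (D * ((Ynat r D n q 0 : ℝ) - D)) with hτdef
  set A : ℝ := ((Lnum r D n + 1 : ℕ) : ℝ) with hAdef
  have hq' : (1 : ℝ) ≤ q := by exact_mod_cast hq
  have hA0 : 0 ≤ A := by rw [hAdef]; positivity
  have hτ0 : 0 ≤ τ := by
    rw [hτdef]
    have : (D : ℝ) < (Ynat r D n q 0 : ℝ) := by exact_mod_cast hY
    apply div_nonneg (by positivity)
    have hD' : (0 : ℝ) < D := by exact_mod_cast hD
    nlinarith
  have hP := Pq_succ_le (s := s) hD hY hτ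
  have hPpos := Pq_pos r D s n q hq
  unfold rho
  have eA : ((Lnum r D n : ℝ) + 1) = A := by rw [hAdef]; push_cast; ring
  rw [eA]
  push_cast
  -- reduce to `q (q+1+A) ≤ (q+A)(q+1)(1-τ)`
  have hkey : τ * ((q : ℝ) + A) * (q + 1) ≤ A := by have h := hτA; rwa [eA] at h
  have h1τ : 0 < 1 - τ := by linarith
  calc ((q : ℝ) + 1 + A) / ((q : ℝ) + 1) * Pq r D s n (q + 1)
      ≤ ((q : ℝ) + 1 + A) / ((q : ℝ) + 1) * (Pq r D s n q / (1 - τ)) :=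
        mul_le_mul_of_nonneg_left hP (by positivity)
    _ ≤ ((q : ℝ) + A) / q * Pq r D s n q := by
        rw [div_mul_div_comm, div_mul_eq_mul_div,
          div_le_div_iff₀ (mul_pos (by positivity) h1τ) (by positivity)]
        have h := mul_nonneg hPpos.le (sub_nonneg.2 hkey)
        nlinarith [h, hPpos, hq', hA0, hτ0]

/-! ### (F2) Eventual decrease -/

/-- **(F2, far range)**: `ρ_q ≤ 1` as soon as `(L+1)·(Drn + Dn + D + 1) ≤ q (σ D (n+1) - (L+1))`
(`s + 1 = Dσ`). [folklore] -/
theorem rho_le_one_far {r D s n σ q : ℕ} (hD : 0 < D) (hS : s + 1 = D * σ) (hq : 1 ≤ q)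
    (h : ((Lnum r D n + 1 : ℕ) : ℝ) * ((D * r * n + D * n + D + 1 : ℕ) : ℝ) ≤
      (q : ℝ) * ((σ : ℝ) * (D * (n + 1)) - ((Lnum r D n + 1 : ℕ) : ℝ))) :
    rho r D s n q ≤ 1 := by
  have hD' : (0 : ℝ) < D := by exact_mod_cast hD
  have hq' : (1 : ℝ) ≤ q := by exact_mod_cast hq
  set A : ℝ := ((Lnum r D n + 1 : ℕ) : ℝ) with hAdef
  set W : ℝ := (Ynat r D n q 0 : ℝ) + 1 with hW
  set c : ℝ := (D : ℝ) * (n + 1) with hc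
  have hc0 : 0 < c := by positivity
  have hW0 : 0 ≤ W := by positivity
  have hP : Pq r D s n q ≤ (W / (W + c)) ^ σ := Pq_le hS
  -- `(W/(W+c))^σ ≤ (W+c)/(W+c+σc)` via `div_pow_le` with `Y = W/c`
  have hP2 : (W / (W + c)) ^ σ ≤ (W + c) / (W + c + σ * c) := by
    have h1 := div_pow_le (W / c) (by positivity) σ
    have e1 : W / c / (W / c + 1) = W / (W + c) := by field_simp
    have e2 : (W / c + 1) / (W / c + 1 + σ) = (W + c) / (W + c + σ * c) := by field_simp
    rwa [e1, e2] at h1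
  have hA0 : 0 ≤ A := by positivity
  have eA : ((Lnum r D n : ℝ) + 1) = A := by rw [hAdef]; push_cast; ring
  unfold rho
  rw [eA]
  have hPW := hP.trans hP2
  calc ((q : ℝ) + A) / q * Pq r D s n q ≤ ((q : ℝ) + A) / q * ((W + c) / (W + c + σ * c)) :=
        mul_le_mul_of_nonneg_left hPW (by positivity)
    _ ≤ 1 := by
        rw [div_mul_div_comm, div_le_one (by positivity)]
        -- `(q+A)(W+c) ≤ q (W+c+σc)` iff `A (W + c) ≤ q σ c`, and `W + c = q + W₀`
        have eW : W + c = (q : ℝ) + ((D * r * n + D * n + D + 1 : ℕ) : ℝ) := by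
          rw [hW, hc]; unfold Ynat; push_cast; ring
        have h' : A * ((D * r * n + D * n + D + 1 : ℕ) : ℝ) ≤ (q : ℝ) * (σ * c - A) := h
        nlinarith [h', hA0, hq']

/-- **(F2, middle range)**: if `(Y₀+1)/(Y₀+1+D(n+1)) ≤ θ` and `(1 + (L+1)/q) θ^σ ≤ 1` then
`ρ_q ≤ 1` (`s+1 = Dσ`). [folklore] -/
theorem rho_le_one_mid {r D s n σ q : ℕ} (hS : s + 1 = D * σ) (hq : 1 ≤ q) {θ : ℝ}
    (hθ : ((Ynat r D n q 0 : ℝ) + 1) / ((Ynat r D n q 0 : ℝ) + 1 + D * (n + 1)) ≤ θ)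
    (h : (1 + ((Lnum r D n + 1 : ℕ) : ℝ) / q) * θ ^ σ ≤ 1) : rho r D s n q ≤ 1 := by
  have hq' : (1 : ℝ) ≤ q := by exact_mod_cast hq
  have hP : Pq r D s n q ≤ θ ^ σ :=
    (Pq_le hS).trans (pow_le_pow_left₀ (by positivity) hθ σ)
  unfold rho
  have e : ((q : ℝ) + (Lnum r D n + 1)) / q = 1 + ((Lnum r D n + 1 : ℕ) : ℝ) / q := by
    push_cast; field_simp
  rw [e]
  exact (mul_le_mul_of_nonneg_left hP (by positivity)).trans h

/-! ### (F4) Growth at a fixed index -/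

/-- **(F4)**: for `1 ≤ q ≤ q₀`, `n ≥ 1`, `r ≥ 1`:
`ρ_q ≥ ((L+1)/q₀) · ((r-1)/(r+1))^σ` (`s+1 = Dσ`). [folklore] -/
theorem rho_ge {r D s n σ q q₀ : ℕ} (hD : 0 < D) (hS : s + 1 = D * σ) (hr : 1 ≤ r) (hn : 1 ≤ n)
    (hq : 1 ≤ q) (hq0 : q ≤ q₀) :
    ((Lnum r D n + 1 : ℕ) : ℝ) / q₀ * (((r : ℝ) - 1) / ((r : ℝ) + 1)) ^ σ ≤ rho r D s n q := by
  have hD' : (0 : ℝ) < D := by exact_mod_cast hD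
  have hr' : (1 : ℝ) ≤ r := by exact_mod_cast hr
  have hn' : (1 : ℝ) ≤ n := by exact_mod_cast hn
  have hq' : (1 : ℝ) ≤ q := by exact_mod_cast hq
  have hq0' : (q : ℝ) ≤ q₀ := by exact_mod_cast hq0
  have hYD : D ≤ Ynat r D n q 0 := by
    unfold Ynat
    have : D * 1 ≤ D * r * n := by
      rw [mul_assoc]; exact Nat.mul_le_mul_left _ (Nat.one_le_iff_ne_zero.2 (by positivity))
    omega
  have hP := Pq_ge (r := r) (D := D) (s := s) (n := n) (q := q) hS hYD
  -- compare the bases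
  have hbase : ((r : ℝ) - 1) / ((r : ℝ) + 1) ≤
      ((Ynat r D n q 0 : ℝ) + 1 - D) / ((Ynat r D n q 0 : ℝ) + 1 + D * n) := by
    unfold Ynat
    push_cast
    rw [div_le_div_iff₀ (by positivity) (by positivity)]
    ring_nf
    nlinarith [mul_nonneg (mul_nonneg hD'.le (by linarith : (0:ℝ) ≤ (r : ℝ) + 1)) (by linarith : (0:ℝ) ≤ (n : ℝ) - 1)]
  have hb0 : 0 ≤ ((r : ℝ) - 1) / ((r : ℝ) + 1) := by
    apply div_nonneg <;> linarith
  have hpow : (((r : ℝ) - 1) / ((r : ℝ) + 1)) ^ σ ≤ Pq r D s n q :=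
    (pow_le_pow_left₀ hb0 hbase σ).trans hP
  unfold rho
  have hcoef : ((Lnum r D n + 1 : ℕ) : ℝ) / q₀ ≤ ((q : ℝ) + (Lnum r D n + 1)) / q := by
    push_cast
    have hq0pos : (0 : ℝ) < q₀ := by linarith
    rw [div_le_div_iff₀ hq0pos (by positivity)]
    have : (0 : ℝ) ≤ (Lnum r D n : ℝ) := Nat.cast_nonneg _
    nlinarith
  calc ((Lnum r D n + 1 : ℕ) : ℝ) / q₀ * (((r : ℝ) - 1) / ((r : ℝ) + 1)) ^ σ
      ≤ ((q : ℝ) + (Lnum r D n + 1)) / q * (((r : ℝ) - 1) / ((r : ℝ) + 1)) ^ σ :=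
        mul_le_mul_of_nonneg_right hcoef (pow_nonneg hb0 _)
    _ ≤ ((q : ℝ) + (Lnum r D n + 1)) / q * Pq r D s n q :=
        mul_le_mul_of_nonneg_left hpow (by positivity)

/-! ### (F5) The upper bound for `∑ u_q` -/

/-- `∑_{q ≥ 0} (q+1+x)^{-E} ≤ x/x^E` (`x > 0`, `E ≥ 2`), by telescoping. [folklore] -/
theorem tsum_one_div_add_pow_le {x : ℝ} (hx : 0 < x) {E : ℕ} (hE : 2 ≤ E) :
    Summable (fun q : ℕ => 1 / ((q : ℝ) + 1 + x) ^ E) ∧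
      ∑' q : ℕ, 1 / ((q : ℝ) + 1 + x) ^ E ≤ x / x ^ E := by
  set g : ℕ → ℝ := fun q => 1 / ((q : ℝ) + x) with hg
  have hf0 : ∀ q : ℕ, 0 ≤ 1 / ((q : ℝ) + 1 + x) ^ E := fun q => by positivity
  have hfg : ∀ q : ℕ, 1 / ((q : ℝ) + 1 + x) ^ E ≤ (1 / x ^ (E - 2)) * (g q - g (q + 1)) := by
    intro q
    have hq0 : (0 : ℝ) ≤ q := Nat.cast_nonneg q
    have e1 : g q - g (q + 1) = 1 / (((q : ℝ) + x) * ((q : ℝ) + 1 + x)) := by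
      rw [hg]; push_cast; field_simp; ring
    rw [e1, one_div_mul_one_div]
    refine one_div_le_one_div_of_le (by positivity) ?_
    have e2 : ((q : ℝ) + 1 + x) ^ E = ((q : ℝ) + 1 + x) ^ (E - 2) * ((q : ℝ) + 1 + x) ^ 2 := by
      rw [← pow_add]; congr 1; omega
    rw [e2]
    have h1 : x ^ (E - 2) ≤ ((q : ℝ) + 1 + x) ^ (E - 2) :=
      pow_le_pow_left₀ hx.le (by linarith) _
    have h2 : ((q : ℝ) + x) * ((q : ℝ) + 1 + x) ≤ ((q : ℝ) + 1 + x) ^ 2 := by nlinarith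
    calc x ^ (E - 2) * (((q : ℝ) + x) * ((q : ℝ) + 1 + x))
        ≤ ((q : ℝ) + 1 + x) ^ (E - 2) * (((q : ℝ) + x) * ((q : ℝ) + 1 + x)) :=
          mul_le_mul_of_nonneg_right h1 (by positivity)
      _ ≤ ((q : ℝ) + 1 + x) ^ (E - 2) * ((q : ℝ) + 1 + x) ^ 2 :=
          mul_le_mul_of_nonneg_left h2 (by positivity)
  have hpartial : ∀ N : ℕ, ∑ q ∈ range N, 1 / ((q : ℝ) + 1 + x) ^ E ≤ x / x ^ E := by
    intro N
    calc ∑ q ∈ range N, 1 / ((q : ℝ) + 1 + x) ^ E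
        ≤ ∑ q ∈ range N, (1 / x ^ (E - 2)) * (g q - g (q + 1)) := sum_le_sum fun q _ => hfg q
      _ = (1 / x ^ (E - 2)) * (g 0 - g N) := by rw [← mul_sum, sum_range_sub']
      _ ≤ (1 / x ^ (E - 2)) * g 0 := by
          have : 0 ≤ g N := by rw [hg]; positivity
          have : 0 ≤ 1 / x ^ (E - 2) := by positivity
          nlinarith
      _ = x / x ^ E := by
          rw [hg]
          simp only [Nat.cast_zero, zero_add]
          have e2 : x ^ E = x ^ (E - 2) * x ^ 2 := by rw [← pow_add]; congr 1; omega
          rw [e2]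
          field_simp
  exact ⟨summable_of_sum_range_le hf0 hpartial, Real.tsum_le_of_sum_range_le hf0 hpartial⟩

/-- The decay rate `γ = (3Dr)^{(2r+1)D} / r^{s+1}`. [folklore] -/
def gam (r D s : ℕ) : ℝ := ((3 * D * r : ℕ) : ℝ) ^ ((2 * r + 1) * D) / (r : ℝ) ^ (s + 1)

/-- `0 < γ`. [folklore] -/
theorem gam_pos {r D s : ℕ} (hD : 0 < D) (hr : 1 ≤ r) : 0 < gam r D s := by
  unfold gam
  have : 0 < 3 * D * r := by positivity
  have : (0 : ℝ) < r := by exact_mod_cast (by omega : 0 < r)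
  positivity

/-- **(F5) Upper bound**: `∑_{q} u_q ≤ 3Dr · γ^n` with `γ = (3Dr)^{(2r+1)D}/r^{s+1}`, using
only `n! ≤ n^n` and `∑_{q≥1}(q+x)^{-E} ≤ x^{1-E}`. [folklore] -/
theorem tsum_useq_le {r D s n : ℕ} (hD : 0 < D) (hr : 1 ≤ r) (hn : 1 ≤ n)
    (hs : (2 * r + 1) * D + 2 ≤ s + 1) :
    Summable (useq r D s n) ∧
      ∑' q, useq r D s n q ≤ ((3 * D * r : ℕ) : ℝ) * gam r D s ^ n := by
  have hD' : (0 : ℝ) < D := by exact_mod_cast hD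
  have hr' : (1 : ℝ) ≤ r := by exact_mod_cast hr
  have hn' : (1 : ℝ) ≤ n := by exact_mod_cast hn
  set S := s + 1 with hSdef
  set e := S - (2 * r + 1) * D with hedef
  set L := Lnum r D n with hLdef
  set E := n * e + (S - 1) with hEdef
  set x : ℝ := ((D * r * n : ℕ) : ℝ) with hxdef
  have hx1 : 1 ≤ x := by
    rw [hxdef]; exact_mod_cast Nat.one_le_iff_ne_zero.2 (by positivity)
  have hx0 : 0 < x := by linarith
  have he2 : 2 ≤ e := by omega
  have hE2 : 2 ≤ E := by
    have : 2 ≤ n * e := le_trans he2 (Nat.le_mul_of_pos_left e hn)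
    omega
  have hEL : E + (L + 1) = (n + 1) * S := by
    rw [hEdef, hLdef, Lnum, hedef]
    have h1 : (2 * r + 1) * D ≤ S := by omega
    zify [h1, (by omega : 1 ≤ S)]
    ring
  -- Step 1: termwise bound
  have hL3 : (L : ℝ) ≤ 3 * x := by
    rw [hLdef, Lnum, hxdef]; push_cast
    nlinarith [mul_nonneg (mul_nonneg hD'.le (by linarith : (0:ℝ) ≤ n)) (by linarith : (0:ℝ) ≤ (r:ℝ) - 1)]
  have hCn : 0 ≤ Cn r D s n := by unfold Cn; positivity
  have hterm : ∀ q : ℕ, useq r D s n (q + 1) ≤ Cn r D s n * 3 ^ (L + 1) / ((q : ℝ) + 1 + x) ^ E := by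
    intro q
    rw [useq_eq hD]
    have hq0 : (0 : ℝ) ≤ q := Nat.cast_nonneg q
    -- numerator
    have hnum : ∏ l ∈ range (L + 1), (((q + 1 : ℕ) : ℝ) + l) ≤ (3 * ((q : ℝ) + 1 + x)) ^ (L + 1) := by
      calc ∏ l ∈ range (L + 1), (((q + 1 : ℕ) : ℝ) + l) ≤ ∏ _l ∈ range (L + 1), (3 * ((q : ℝ) + 1 + x)) := by
            refine prod_le_prod (fun l _ => by positivity) fun l hl => ?_
            have : (l : ℝ) ≤ L := by exact_mod_cast Nat.lt_succ_iff.1 (mem_range.1 hl)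
            push_cast; nlinarith
        _ = _ := by rw [prod_const, card_range]
    -- denominator
    have hden : ((q : ℝ) + 1 + x) ^ ((n + 1) * S) ≤
        ∏ k ∈ range (n + 1), (Ynat r D n (q + 1) k : ℝ) ^ (s + 1) := by
      calc ((q : ℝ) + 1 + x) ^ ((n + 1) * S) = ∏ _k ∈ range (n + 1), ((q : ℝ) + 1 + x) ^ S := by
            rw [prod_const, card_range, ← pow_mul, mul_comm]
        _ ≤ _ := by
            refine prod_le_prod (fun k _ => by positivity) fun k _ => ?_
            refine pow_le_pow_left₀ (by positivity) ?_ _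
            unfold Ynat; rw [hxdef]; push_cast; nlinarith [(Nat.cast_nonneg (α := ℝ) (D * k))]
    have hdenpos : 0 < ∏ k ∈ range (n + 1), (Ynat r D n (q + 1) k : ℝ) ^ (s + 1) :=
      lt_of_lt_of_le (by positivity) hden
    rw [div_le_div_iff₀ hdenpos (by positivity)]
    calc Cn r D s n * (∏ l ∈ range (L + 1), (((q + 1 : ℕ) : ℝ) + l)) * ((q : ℝ) + 1 + x) ^ E
        ≤ Cn r D s n * (3 * ((q : ℝ) + 1 + x)) ^ (L + 1) * ((q : ℝ) + 1 + x) ^ E := by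
          gcongr
      _ = Cn r D s n * 3 ^ (L + 1) * ((q : ℝ) + 1 + x) ^ ((n + 1) * S) := by
          rw [← hEL, mul_pow]; ring
      _ ≤ Cn r D s n * 3 ^ (L + 1) * ∏ k ∈ range (n + 1), (Ynat r D n (q + 1) k : ℝ) ^ (s + 1) :=
          mul_le_mul_of_nonneg_left hden (by positivity)
  -- Step 2: summability and the sum bound
  obtain ⟨hsf, htf⟩ := tsum_one_div_add_pow_le hx0 hE2
  have hsucc : Summable (fun q : ℕ => useq r D s n (q + 1)) := by
    refine (hsf.mul_left (Cn r D s n * 3 ^ (L + 1))).of_nonneg_of_le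
      (fun q => (useq_pos hD (by omega)).le) fun q => ?_
    rw [mul_one_div]; exact hterm q
  have hsum : Summable (useq r D s n) := (summable_nat_add_iff 1).1 hsucc
  refine ⟨hsum, ?_⟩
  rw [hsum.tsum_eq_zero_add, useq_zero, zero_add]
  have hbd : ∑' q : ℕ, useq r D s n (q + 1) ≤ Cn r D s n * 3 ^ (L + 1) * (x / x ^ E) := by
    calc ∑' q : ℕ, useq r D s n (q + 1) ≤ ∑' q : ℕ, Cn r D s n * 3 ^ (L + 1) * (1 / ((q : ℝ) + 1 + x) ^ E) :=
          hsucc.tsum_le_tsum (fun q => by rw [mul_one_div]; exact hterm q) (hsf.mul_left _)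
      _ = Cn r D s n * 3 ^ (L + 1) * ∑' q : ℕ, 1 / ((q : ℝ) + 1 + x) ^ E := tsum_mul_left
      _ ≤ Cn r D s n * 3 ^ (L + 1) * (x / x ^ E) := mul_le_mul_of_nonneg_left htf (by positivity)
  refine hbd.trans ?_
  -- Step 3: `C_n 3^{L+1} x / x^E ≤ 3Dr γ^n`
  have hγ : ((3 * D * r : ℕ) : ℝ) * gam r D s ^ n = ((3 * D * r : ℕ) : ℝ) ^ (L + 1) / (r : ℝ) ^ (S * n) := by
    rw [gam, div_pow, ← pow_mul, ← pow_mul, hLdef, Lnum, pow_succ, hSdef]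
    rw [show (2 * r + 1) * D * n = ((2 * r + 1) * D) * n by ring]
    field_simp
  rw [hγ]
  have hrpos : (0 : ℝ) < (r : ℝ) ^ (S * n) := by positivity
  have hxE : (0 : ℝ) < x ^ E := by positivity
  rw [Cn, le_div_iff₀ hrpos]
  -- clear the remaining denominators `D` and `x^E`
  rw [show (n ! : ℝ) ^ (s + 1 - (2 * r + 1) * D) * (D : ℝ) ^ ((n + 1) * (s + 1)) / D * 3 ^ (L + 1) *
      (x / x ^ E) * (r : ℝ) ^ (S * n) =
      ((n ! : ℝ) ^ e * (D : ℝ) ^ ((n + 1) * S) * 3 ^ (L + 1) * x * (r : ℝ) ^ (S * n)) / (D * x ^ E) by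
    rw [← hedef, ← hSdef]; field_simp]
  rw [div_le_iff₀ (by positivity)]
  -- now everything is a product of powers
  have hfac : (n ! : ℝ) ^ e ≤ (n : ℝ) ^ (n * e) := by
    rw [pow_mul]
    exact pow_le_pow_left₀ (by positivity) (by exact_mod_cast Nat.factorial_le_pow n) e
  have hxpow : x ^ E = (D : ℝ) ^ E * (r : ℝ) ^ E * (n : ℝ) ^ E := by
    rw [hxdef]; push_cast; rw [mul_pow, mul_pow]
  rw [hxpow]
  have h3Dr : ((3 * D * r : ℕ) : ℝ) ^ (L + 1) = 3 ^ (L + 1) * (D : ℝ) ^ (L + 1) * (r : ℝ) ^ (L + 1) := by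
    push_cast; rw [mul_pow, mul_pow]
  rw [h3Dr]
  -- compare exponents
  have hDexp : (D : ℝ) ^ ((n + 1) * S) = (D : ℝ) ^ (L + 1) * (D : ℝ) ^ E := by
    rw [← pow_add, ← hEL, add_comm]
  have hrexp : x * (r : ℝ) ^ (S * n) ≤ (D : ℝ) * n * (r : ℝ) ^ ((n + 1) * S) := by
    have : (r : ℝ) * (r : ℝ) ^ (S * n) ≤ (r : ℝ) ^ ((n + 1) * S) := by
      rw [← pow_succ']
      exact pow_le_pow_right₀ hr' (by nlinarith)
    calc x * (r : ℝ) ^ (S * n) = (D : ℝ) * n * ((r : ℝ) * (r : ℝ) ^ (S * n)) := by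
          rw [hxdef]; push_cast; ring
      _ ≤ (D : ℝ) * n * (r : ℝ) ^ ((n + 1) * S) := mul_le_mul_of_nonneg_left this (by positivity)
  have hnexp : (n : ℝ) ^ (n * e) * n ≤ (n : ℝ) ^ E := by
    rw [← pow_succ]
    exact pow_le_pow_right₀ hn' (by omega)
  have hrsplit : (r : ℝ) ^ ((n + 1) * S) = (r : ℝ) ^ (L + 1) * (r : ℝ) ^ E := by
    rw [← pow_add, ← hEL, add_comm]
  calc (n ! : ℝ) ^ e * (D : ℝ) ^ ((n + 1) * S) * 3 ^ (L + 1) * x * (r : ℝ) ^ (S * n)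
      = (n ! : ℝ) ^ e * (D : ℝ) ^ ((n + 1) * S) * 3 ^ (L + 1) * (x * (r : ℝ) ^ (S * n)) := by ring
    _ ≤ (n : ℝ) ^ (n * e) * (D : ℝ) ^ ((n + 1) * S) * 3 ^ (L + 1) * ((D : ℝ) * n * (r : ℝ) ^ ((n + 1) * S)) := by
        gcongr
    _ = 3 ^ (L + 1) * (D : ℝ) ^ (L + 1) * (r : ℝ) ^ (L + 1) *
          ((D : ℝ) * ((D : ℝ) ^ E * (r : ℝ) ^ E * ((n : ℝ) ^ (n * e) * n))) := by
        rw [hDexp, hrsplit]; ring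
    _ ≤ 3 ^ (L + 1) * (D : ℝ) ^ (L + 1) * (r : ℝ) ^ (L + 1) *
          ((D : ℝ) * ((D : ℝ) ^ E * (r : ℝ) ^ E * (n : ℝ) ^ E)) := by
        gcongr

end Literature.NumberTheory.Transcendental.OddZeta
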